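import Literature.NumberTheory.LFunctions.NoRealZeroCertificateReplayTableCheckT2
import HarnessLib
/-!
# Kernel replay of the Lu–Zaman–Zhao certificates: the verified prime table for `2097152 ≤ p < 5881800` (part P157)

Topic `Literature/NumberTheory/LFunctions`. Literal data + kernel verification, no mathematics (same
pattern as `NoRealZeroCertificateReplayTableA/B.lean`, which hold `table15`, `p < 2^15`): for each prime
`2097152 ≤ p < 5881800` of this part, the prime and three natural numbers CLAIMED to be at most
`2^64 · 2 log p/(p^σ − 1)`, `2^64 · log p/(p^σ − 1)`, `2^64 · 2 log p/(p^{2σ} − 1)` (`σ = 1 + 1.6/(10 log 10)`;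
the three possible summands of the prime sum (2.3) of Lu–Zaman–Zhao, arXiv:2602.03626, row `λ = 1.6` of
their Table 1), generated outside Lean (50-digit decimal arithmetic, rounded DOWN with a relative
margin `10⁻⁹`); the theorems `table22Block*_check` re-derive every entry INSIDE THE KERNEL
(`LuZamanZhao2026.Replay.tableCheck`: primality by trial division, the three enclosures by the tree's
interval engine; `decide +kernel`). A wrong entry could only make a check fail
(`entryValid_of_tableCheck`), never prove a false statement. Purpose: the HEAVY rows of the
certificate replay (item `ReplayedCertificates` of route `LZZCertificateReplay`, `parity-realchar`
cell), whose certificates need primes beyond `2^15`.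

## References

* W. Lu, A. Zaman, K. Zhao, *Dirichlet L-functions of quadratic characters have no exceptional
  zeros for moduli up to 10¹⁰*, Math. Comp. (2026), arXiv:2602.03626, §2.2 and (2.3).
  [LuZamanZhao2026]
-/

namespace Literature.NumberTheory.LFunctions
namespace LuZamanZhao2026
namespace Replay

/-- Block 2496 of `table22`: the primes `5881487 ≤ p ≤ 5881793` (23 entries; literal data, verified by `table22Block2496_check`). [folklore] -/
def table22Block2496 : List PRow := [
  ⟨5881487, 33101060794862, 16550530397430, 1905294⟩, ⟨5881501, 33100981582771, 16550490791384, 1905285⟩, ⟨5881511, 33100925002936, 16550462501467, 1905278⟩, ⟨5881517, 33100891055128, 16550445527563, 1905274⟩,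
  ⟨5881523, 33100857107389, 16550428553693, 1905270⟩, ⟨5881543, 33100743948760, 16550371974379, 1905256⟩, ⟨5881567, 33100608159421, 16550304079709, 1905240⟩, ⟨5881597, 33100438424308, 16550219212153, 1905220⟩,
  ⟨5881607, 33100381846321, 16550190923159, 1905213⟩, ⟨5881633, 33100234744458, 16550117372228, 1905196⟩, ⟨5881637, 33100212113518, 16550106056758, 1905193⟩, ⟨5881639, 33100200798059, 16550100399028, 1905192⟩,
  ⟨5881649, 33100144220881, 16550072110439, 1905185⟩, ⟨5881657, 33100098959278, 16550049479638, 1905180⟩, ⟨5881699, 33099861337880, 16549930668939, 1905152⟩, ⟨5881703, 33099838707448, 16549919353723, 1905149⟩,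
  ⟨5881709, 33099804761857, 16549902380927, 1905145⟩, ⟨5881717, 33099759501178, 16549879750588, 1905140⟩, ⟨5881727, 33099702925502, 16549851462750, 1905133⟩, ⟨5881739, 33099635034944, 16549817517471, 1905125⟩,
  ⟨5881747, 33099589774727, 16549794887362, 1905119⟩, ⟨5881783, 33099386105272, 16549693052635, 1905095⟩, ⟨5881793, 33099329530866, 16549664765432, 1905088⟩]

set_option maxHeartbeats 0 in
/-- Kernel verification of `table22Block2496`: every listed `p` is prime and the three naturals are below the kernel's own lower bounds of the three summands of (2.3). [cite: LuZamanZhao2026, §2.2 and (2.3)] -/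
theorem table22Block2496_check :
    (match rI with | some R => tableCheckT2 R table22Block2496 | none => false) = true := by
  decide +kernel

/-- Part P157 of `table22` (blocks 2496–2496, primes `5881487 ≤ p ≤ 5881793`), right-nested. [folklore] -/
def table22P157 : List PRow :=
  table22Block2496

/-- Every entry of `table22P157` is valid (kernel-verified blockwise). [cite: LuZamanZhao2026, §2.2 and (2.3)] -/
theorem table22P157_entryValid : ∀ e ∈ table22P157, EntryValid e :=
  (entryValid_of_chunkT2 table22Block2496_check)

end Replay
end LuZamanZhao2026
end Literature.NumberTheory.LFunctions
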